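import Mathlib.RingTheory.RegularLocalRing.Polynomial
import Mathlib.RingTheory.AlgebraicIndependent.Basic
import Mathlib.RingTheory.MvPolynomial.Ideal
import Mathlib.RingTheory.Localization.AtPrime.Basic
import Mathlib.RingTheory.LocalRing.RingHom.Basic
import Literature.AlgebraicGeometry.Resolution.AffineDomainEquidim
import HarnessLib

/-!
# The local ring of affine space at a rational point, inside an extension field

Topic: `Literature/AlgebraicGeometry/Resolution`. For a field `F`, an `F`-algebra `L` which is a
field, and an algebraically independent family `x : Fin n → L`, the **algebraic local ring**
`F[x₁, …, xₙ]_{(x₁, …, xₙ)} ⊆ L` — the local ring of the affine space `𝔸ⁿ_F` at the origin,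
realised inside `L` at the point `x` ("`A = k[u,v]_{(u,v)}`, `B = k[x,y]_{(x,y)}`" in Cutkosky's
counterexample to local monomialization, whose rings `A_i = k[u_i,v_i]_{(u_i,v_i)}`,
`B_i = k[x_i, y_i]_{(x_i,y_i)}` are all of this form; this file is infrastructure for the
discharge of `Literature.Barriers.ResolutionOfSingularities.Cutkosky.Cutkosky2014`).

## Content (all proved)

* `originIdeal F n = ker (f ↦ f(0)) = (X₁, …, Xₙ)`, a maximal ideal of `F[X₁, …, Xₙ]`;
  `OriginLocalization F n = F[X]_{(X)}`, a regular local ring of dimension `n`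
  (Mathlib: polynomial rings over regular rings are regular; the tree's
  `ringKrullDim_localization_atPrime_eq_of_isMaximal`, Matsumura Thm. 5.6 / Ex. 5.1).
* `originLocalRing hx : Subalgebra F L` for `hx : AlgebraicIndependent F x` — the image of
  `F[X]_{(X)}` under `X ↦ x`, with `originLocalRingEquiv : F[X]_{(X)} ≃ₐ[F] originLocalRing hx`;
  hence it is a regular local ring of dimension `n` whose maximal ideal is generated by the
  `x i` (`maximalIdeal_originLocalRing`: `x` is a regular system of parameters).
* Membership: `q ∈ originLocalRing hx ↔ q = f(x)/g(x)` with `g(0) ≠ 0`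
  (`mem_originLocalRing_iff`); `f(x)/g(x)` lies in the maximal ideal iff `f(0) = 0`; every
  element is congruent to a scalar modulo the maximal ideal (residue field `F`).
* Inclusion-with-domination criterion (`originLocalRing_le_of_forall_mem_maximalIdeal`,
  `inv_mem_originLocalRing_of_forall_mem_maximalIdeal`): if the `x i` lie in the maximal ideal of
  `F[y]_{(y)}` then `F[x]_{(x)} ⊆ F[y]_{(y)}` and the latter dominates the former — the shape of
  every inclusion `A ⊆ B`, `B_i ⊆ B_{i+1}` in Cutkosky §3.

## Sources

Standard commutative algebra (Matsumura, *Commutative Ring Theory*, §5 and §14, regular local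
rings of points of `𝔸ⁿ`); S. D. Cutkosky, Math. Ann. 362 (2015), §2.1 ("algebraic local ring")
and §3. Everything here is [folklore].
-/

noncomputable section

namespace Literature.AlgebraicGeometry.Resolution

universe u v

open _root_.MvPolynomial IsLocalRing

section Polynomial

variable (F : Type u) [Field F] (n : ℕ)

/-- The ideal `(X₁, …, Xₙ) ⊆ F[X₁, …, Xₙ]` of the origin: the kernel of `f ↦ f(0)`. [folklore] -/
abbrev originIdeal : Ideal (MvPolynomial (Fin n) F) :=
  RingHom.ker (constantCoeff : MvPolynomial (Fin n) F →+* F)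

/-- `f ↦ f(0)` is surjective. [folklore] -/
theorem constantCoeff_surjective :
    Function.Surjective (constantCoeff : MvPolynomial (Fin n) F →+* F) :=
  fun a => ⟨C a, constantCoeff_C _ a⟩

/-- The ideal of the origin is maximal (a rational point). [folklore] -/
instance originIdeal.isMaximal : (originIdeal F n).IsMaximal :=
  RingHom.ker_isMaximal_of_surjective _ (constantCoeff_surjective F n)

/-- Membership in the ideal of the origin: `f(0) = 0`. [folklore] -/
theorem mem_originIdeal_iff {f : MvPolynomial (Fin n) F} : f ∈ originIdeal F n ↔ constantCoeff f = 0 :=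
  RingHom.mem_ker

/-- The ideal of the origin is generated by the variables. [folklore] -/
theorem originIdeal_eq_span : originIdeal F n = Ideal.span (Set.range (X : Fin n → MvPolynomial (Fin n) F)) := by
  ext f
  rw [mem_originIdeal_iff, ← Set.image_univ, mem_ideal_span_X_image, constantCoeff_eq]
  constructor
  · intro h m hm
    have hm0 : m ≠ 0 := by
      rintro rfl
      exact (mem_support_iff.mp hm) h
    obtain ⟨i, hi⟩ := Finsupp.ne_iff.mp hm0
    exact ⟨i, Set.mem_univ _, hi⟩
  · intro h
    by_contra hne
    obtain ⟨i, -, hi⟩ := h 0 (mem_support_iff.mpr hne)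
    exact hi rfl

/-- **`F[X₁, …, Xₙ]_{(X₁, …, Xₙ)}`**, the local ring of `𝔸ⁿ_F` at the origin. [folklore] -/
abbrev OriginLocalization : Type u := Localization.AtPrime (originIdeal F n)

/-- `F[X]_{(X)}` is a regular local ring (Mathlib: localisations of the regular ring `F[X]`).
[folklore] -/
instance OriginLocalization.isRegularLocalRing : IsRegularLocalRing (OriginLocalization F n) :=
  inferInstance

/-- `dim F[X₁, …, Xₙ]_{(X)} = n` (equidimensionality of affine space at closed points).
[folklore] -/
theorem ringKrullDim_originLocalization : ringKrullDim (OriginLocalization F n) = n := by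
  rw [ringKrullDim_localization_atPrime_eq_of_isMaximal F (originIdeal F n),
    MvPolynomial.ringKrullDim_of_isNoetherianRing, ringKrullDim_eq_zero_of_field]
  simp

end Polynomial

section Field

variable {F : Type u} [Field F] {n : ℕ} {L : Type v} [Field L] [Algebra F L] {x : Fin n → L}

/-- Off the ideal of the origin, `g(x) ≠ 0` for algebraically independent `x` (indeed `g ≠ 0`).
[folklore] -/
theorem isUnit_aeval_of_mem_primeCompl (hx : AlgebraicIndependent F x)
    (g : (originIdeal F n).primeCompl) : IsUnit (aeval x (g : MvPolynomial (Fin n) F)) := by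
  have hinj := algebraicIndependent_iff_injective_aeval.mp hx
  rw [isUnit_iff_ne_zero]
  intro h0
  apply g.2
  have : (g : MvPolynomial (Fin n) F) = 0 := hinj (by rw [h0, map_zero])
  rw [this]
  exact Ideal.zero_mem _

/-- `g(x) ≠ 0` when `g(0) ≠ 0`, for algebraically independent `x`. [folklore] -/
theorem aeval_ne_zero_of_constantCoeff_ne_zero (hx : AlgebraicIndependent F x)
    {g : MvPolynomial (Fin n) F} (hg : constantCoeff g ≠ 0) : aeval x g ≠ 0 :=
  (isUnit_aeval_of_mem_primeCompl hx ⟨g, fun h => hg ((mem_originIdeal_iff F n).mp h)⟩).ne_zero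

/-- The evaluation `F[X]_{(X)} → L`, `X ↦ x`, for algebraically independent `x`. [folklore] -/
def originEmb (hx : AlgebraicIndependent F x) : OriginLocalization F n →ₐ[F] L :=
  IsLocalization.liftAlgHom (M := (originIdeal F n).primeCompl) (f := aeval x)
    (isUnit_aeval_of_mem_primeCompl hx)

/-- `originEmb` on a fraction `f/g`. [folklore] -/
theorem originEmb_mk' (hx : AlgebraicIndependent F x) (f : MvPolynomial (Fin n) F)
    (g : (originIdeal F n).primeCompl) :
    originEmb hx (IsLocalization.mk' _ f g) = aeval x f / aeval x (g : MvPolynomial (Fin n) F) := by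
  have hg0 := (isUnit_aeval_of_mem_primeCompl hx g).ne_zero
  rw [originEmb, IsLocalization.liftAlgHom_apply]
  refine (IsLocalization.lift_mk'_spec _ _ _ _).mpr ?_
  change aeval x f = aeval x (g : MvPolynomial (Fin n) F) *
    (aeval x f / aeval x (g : MvPolynomial (Fin n) F))
  rw [mul_comm, div_mul_cancel₀ _ hg0]

/-- `originEmb` on a polynomial. [folklore] -/
theorem originEmb_algebraMap (hx : AlgebraicIndependent F x) (f : MvPolynomial (Fin n) F) :
    originEmb hx (algebraMap _ _ f) = aeval x f := by
  rw [originEmb, IsLocalization.liftAlgHom_apply, IsLocalization.lift_eq]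
  rfl

/-- The evaluation `F[X]_{(X)} → L` at an algebraically independent point is injective. [folklore] -/
theorem originEmb_injective (hx : AlgebraicIndependent F x) : Function.Injective (originEmb hx) := by
  rw [originEmb, IsLocalization.coe_liftAlgHom, IsLocalization.lift_injective_iff]
  intro a b
  rw [(IsLocalization.injective (OriginLocalization F n) (originIdeal F n).primeCompl_le_nonZeroDivisors).eq_iff]
  exact ((algebraicIndependent_iff_injective_aeval.mp hx).eq_iff (a := a) (b := b)).symm

/-- **The algebraic local ring `F[x₁, …, xₙ]_{(x₁, …, xₙ)} ⊆ L`** at an algebraically independent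
point `x` of the `F`-field `L`: the fractions `f(x)/g(x)`, `g(0) ≠ 0` (`mem_originLocalRing_iff`).
[folklore] -/
def originLocalRing (hx : AlgebraicIndependent F x) : Subalgebra F L :=
  (originEmb hx).range

/-- `F[X]_{(X)} ≃ F[x]_{(x)}`. [folklore] -/
def originLocalRingEquiv (hx : AlgebraicIndependent F x) :
    OriginLocalization F n ≃ₐ[F] originLocalRing hx :=
  AlgEquiv.ofInjective (originEmb hx) (originEmb_injective hx)

/-- The equivalence is the evaluation. [folklore] -/
theorem coe_originLocalRingEquiv (hx : AlgebraicIndependent F x) (z : OriginLocalization F n) :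
    ((originLocalRingEquiv hx z : originLocalRing hx) : L) = originEmb hx z :=
  AlgEquiv.ofInjective_apply _ _ z

/-- **Membership**: `q ∈ F[x]_{(x)}` iff `q = f(x)/g(x)` with `g(0) ≠ 0`. [folklore] -/
theorem mem_originLocalRing_iff (hx : AlgebraicIndependent F x) {q : L} :
    q ∈ originLocalRing hx ↔
      ∃ f g : MvPolynomial (Fin n) F, constantCoeff g ≠ 0 ∧ q = aeval x f / aeval x g := by
  constructor
  · rintro ⟨z, rfl⟩
    obtain ⟨⟨f, g⟩, rfl⟩ := IsLocalization.mk'_surjective (originIdeal F n).primeCompl z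
    exact ⟨f, g, fun h => g.2 ((mem_originIdeal_iff F n).mpr h), originEmb_mk' hx f g⟩
  · rintro ⟨f, g, hg, rfl⟩
    exact ⟨IsLocalization.mk' (OriginLocalization F n) f
        (⟨g, fun h => hg ((mem_originIdeal_iff F n).mp h)⟩ : (originIdeal F n).primeCompl),
      originEmb_mk' hx f _⟩

/-- Polynomials in `x` lie in `F[x]_{(x)}`. [folklore] -/
theorem aeval_mem_originLocalRing (hx : AlgebraicIndependent F x) (f : MvPolynomial (Fin n) F) :
    aeval x f ∈ originLocalRing hx :=
  ⟨algebraMap _ _ f, originEmb_algebraMap hx f⟩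

/-- The coordinates lie in `F[x]_{(x)}`. [folklore] -/
theorem mem_originLocalRing_self (hx : AlgebraicIndependent F x) (i : Fin n) :
    x i ∈ originLocalRing hx := by
  simpa using aeval_mem_originLocalRing hx (X i)

/-- `F[x] ⊆ F[x]_{(x)}`. [folklore] -/
theorem adjoin_le_originLocalRing (hx : AlgebraicIndependent F x) :
    Algebra.adjoin F (Set.range x) ≤ originLocalRing hx :=
  Algebra.adjoin_le (by rintro _ ⟨i, rfl⟩; exact mem_originLocalRing_self hx i)

/-- `F[x]_{(x)}` is a local ring. [folklore] -/
theorem isLocalRing_originLocalRing (hx : AlgebraicIndependent F x) :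
    IsLocalRing (originLocalRing hx) :=
  (originLocalRingEquiv hx).toRingEquiv.isLocalRing

/-- **`F[x]_{(x)}` is a regular local ring.** [folklore] -/
theorem isRegularLocalRing_originLocalRing (hx : AlgebraicIndependent F x) :
    IsRegularLocalRing (originLocalRing hx) :=
  IsRegularLocalRing.of_ringEquiv (originLocalRingEquiv hx).toRingEquiv

/-- **`dim F[x₁, …, xₙ]_{(x)} = n`.** [folklore] -/
theorem ringKrullDim_originLocalRing (hx : AlgebraicIndependent F x) :
    ringKrullDim (originLocalRing hx) = n := by
  rw [← ringKrullDim_eq_of_ringEquiv (originLocalRingEquiv hx).toRingEquiv,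
    ringKrullDim_originLocalization]

/-- The coordinate `x i` as an element of `F[x]_{(x)}`. [folklore] -/
def originCoord (hx : AlgebraicIndependent F x) (i : Fin n) : originLocalRing hx :=
  ⟨x i, mem_originLocalRing_self hx i⟩

/-- `originCoord` is the coordinate. [folklore] -/
@[simp] theorem coe_originCoord (hx : AlgebraicIndependent F x) (i : Fin n) :
    (originCoord hx i : L) = x i := rfl

/-- The equivalence sends `Xᵢ` to `xᵢ`. [folklore] -/
theorem originLocalRingEquiv_X (hx : AlgebraicIndependent F x) (i : Fin n) :
    originLocalRingEquiv hx (algebraMap (MvPolynomial (Fin n) F) (OriginLocalization F n) (X i)) =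
      originCoord hx i := by
  apply Subtype.ext
  rw [coe_originLocalRingEquiv, originEmb_algebraMap, aeval_X, coe_originCoord]

/-- **The coordinates form a regular system of parameters**: the maximal ideal of
`F[x]_{(x)}` is `(x₁, …, xₙ)`. [folklore] -/
theorem maximalIdeal_originLocalRing (hx : AlgebraicIndependent F x) :
    (haveI := isLocalRing_originLocalRing hx;
      maximalIdeal (originLocalRing hx)) = Ideal.span (Set.range (originCoord hx)) := by
  haveI := isLocalRing_originLocalRing hx
  have h1 : (originIdeal F n).map (algebraMap _ (OriginLocalization F n)) =
      Ideal.span (Set.range fun i =>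
        algebraMap (MvPolynomial (Fin n) F) (OriginLocalization F n) (X i)) := by
    conv_lhs => arg 2; rw [originIdeal_eq_span]
    rw [Ideal.map_span, ← Set.range_comp]
    rfl
  rw [← map_ringEquiv_maximalIdeal (originLocalRingEquiv hx).toRingEquiv,
    ← Localization.AtPrime.map_eq_maximalIdeal, h1, Ideal.map_span, ← Set.range_comp]
  congr 1
  congr 1
  funext i
  exact originLocalRingEquiv_X hx i

/-- **Maximal-ideal membership of a fraction**: for `g(0) ≠ 0`, `f(x)/g(x)` lies in the maximal
ideal of `F[x]_{(x)}` iff `f(0) = 0`. [folklore] -/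
theorem div_mem_maximalIdeal_originLocalRing_iff (hx : AlgebraicIndependent F x)
    (f g : MvPolynomial (Fin n) F) (hg : constantCoeff g ≠ 0)
    (hmem : aeval x f / aeval x g ∈ originLocalRing hx) :
    (haveI := isLocalRing_originLocalRing hx;
      (⟨aeval x f / aeval x g, hmem⟩ : originLocalRing hx) ∈ maximalIdeal (originLocalRing hx)) ↔
      constantCoeff f = 0 := by
  haveI := isLocalRing_originLocalRing hx
  set g' : (originIdeal F n).primeCompl := ⟨g, fun h => hg ((mem_originIdeal_iff F n).mp h)⟩
  have he : (⟨aeval x f / aeval x g, hmem⟩ : originLocalRing hx) =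
      originLocalRingEquiv hx (IsLocalization.mk' _ f g') :=
    Subtype.ext (by rw [coe_originLocalRingEquiv, originEmb_mk' hx f g'])
  rw [he, ← mem_originIdeal_iff F n,
    ← IsLocalization.AtPrime.mk'_mem_maximal_iff (OriginLocalization F n) (originIdeal F n) f g']
  -- membership in the maximal ideal is invariant under the ring isomorphism
  rw [IsLocalRing.mem_maximalIdeal, IsLocalRing.mem_maximalIdeal, mem_nonunits_iff,
    mem_nonunits_iff, not_iff_not]
  exact MulEquiv.isUnit_map (originLocalRingEquiv hx)

/-- **Residue field `F`**: every element of `F[x]_{(x)}` is congruent to a scalar modulo the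
maximal ideal (`f(x)/g(x) ≡ f(0)/g(0)`). [folklore] -/
theorem exists_sub_algebraMap_mem_maximalIdeal (hx : AlgebraicIndependent F x)
    (q : originLocalRing hx) :
    ∃ c : F, (haveI := isLocalRing_originLocalRing hx;
      q - algebraMap F (originLocalRing hx) c ∈ maximalIdeal (originLocalRing hx)) := by
  haveI := isLocalRing_originLocalRing hx
  obtain ⟨f, g, hg, hq⟩ := (mem_originLocalRing_iff hx).mp q.2
  refine ⟨constantCoeff f / constantCoeff g, ?_⟩
  have hg0 := aeval_ne_zero_of_constantCoeff_ne_zero hx hg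
  -- `q - f(0)/g(0) = (f - (f(0)/g(0)) g)(x) / g(x)`, and the numerator vanishes at `0`
  have hmem : aeval x (f - C (constantCoeff f / constantCoeff g) * g) / aeval x g ∈ originLocalRing hx :=
    (mem_originLocalRing_iff hx).mpr ⟨_, g, hg, rfl⟩
  have key : q - algebraMap F (originLocalRing hx) (constantCoeff f / constantCoeff g) =
      ⟨aeval x (f - C (constantCoeff f / constantCoeff g) * g) / aeval x g, hmem⟩ := by
    apply Subtype.ext
    change (q : L) - algebraMap F L (constantCoeff f / constantCoeff g) =
      aeval x (f - C (constantCoeff f / constantCoeff g) * g) / aeval x g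
    rw [hq, map_sub, map_mul, aeval_C, sub_div, mul_div_assoc, div_self hg0, mul_one]
  rw [key, div_mem_maximalIdeal_originLocalRing_iff hx _ g hg hmem]
  simp [hg]

/-- Scalars `c ≠ 0` are units of `F[x]_{(x)}`; more generally an element congruent to a nonzero
scalar modulo the maximal ideal is a unit. [folklore] -/
theorem isUnit_of_sub_algebraMap_mem_maximalIdeal (hx : AlgebraicIndependent F x)
    {q : originLocalRing hx} {c : F} (hc : c ≠ 0)
    (h : haveI := isLocalRing_originLocalRing hx;
      q - algebraMap F (originLocalRing hx) c ∈ maximalIdeal (originLocalRing hx)) : IsUnit q := by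
  haveI := isLocalRing_originLocalRing hx
  by_contra hq
  have hq' : q ∈ maximalIdeal (originLocalRing hx) := hq
  have : algebraMap F (originLocalRing hx) c ∈ maximalIdeal (originLocalRing hx) := by
    simpa using (maximalIdeal (originLocalRing hx)).sub_mem hq' h
  exact (IsLocalRing.mem_maximalIdeal _ |>.mp this) ((IsUnit.mk0 c hc).map _)

/-! ## Inclusions `F[x]_{(x)} ⊆ F[y]_{(y)}` with domination -/

/-- Evaluation of polynomials inside a subalgebra agrees with evaluation in `L`. [folklore] -/
theorem coe_aeval_subalgebra (S : Subalgebra F L) (x' : Fin n → S) (f : MvPolynomial (Fin n) F) :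
    ((aeval x' f : S) : L) = aeval (fun i => (x' i : L)) f := by
  change S.val (aeval x' f) = _
  rw [← AlgHom.comp_apply, comp_aeval]
  rfl

/-- A polynomial without constant term, evaluated at elements of the maximal ideal of a local
`F`-algebra, lies in the maximal ideal. [folklore] -/
theorem aeval_mem_maximalIdeal_of_constantCoeff_eq_zero {S : Type*} [CommRing S] [Algebra F S]
    [IsLocalRing S] (x' : Fin n → S) (hmax : ∀ i, x' i ∈ maximalIdeal S)
    {f : MvPolynomial (Fin n) F} (hf : constantCoeff f = 0) : aeval x' f ∈ maximalIdeal S := by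
  have hf' : f ∈ Ideal.span (Set.range (X : Fin n → MvPolynomial (Fin n) F)) := by
    rw [← originIdeal_eq_span, mem_originIdeal_iff]; exact hf
  have h1 : aeval x' f ∈ (Ideal.span (Set.range (X : Fin n → MvPolynomial (Fin n) F))).map (aeval x') :=
    Ideal.mem_map_of_mem _ hf'
  rw [Ideal.map_span, ← Set.range_comp] at h1
  refine (Ideal.span_le.mpr ?_) h1
  rintro _ ⟨i, rfl⟩
  simpa using hmax i

/-- A polynomial with nonzero constant term, evaluated at elements of the maximal ideal of a
local `F`-algebra, is a unit. [folklore] -/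
theorem isUnit_aeval_of_constantCoeff_ne_zero {S : Type*} [CommRing S] [Algebra F S]
    [IsLocalRing S] (x' : Fin n → S) (hmax : ∀ i, x' i ∈ maximalIdeal S)
    {g : MvPolynomial (Fin n) F} (hg : constantCoeff g ≠ 0) : IsUnit (aeval x' g) := by
  have h1 : aeval x' (g - C (constantCoeff g)) ∈ maximalIdeal S :=
    aeval_mem_maximalIdeal_of_constantCoeff_eq_zero x' hmax (by simp)
  by_contra hu
  have h2 : aeval x' g ∈ maximalIdeal S := hu
  have h3 : algebraMap F S (constantCoeff g) ∈ maximalIdeal S := by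
    have := (maximalIdeal S).sub_mem h2 h1
    simpa using this
  exact (IsLocalRing.mem_maximalIdeal _ |>.mp h3) ((IsUnit.mk0 _ hg).map _)

variable {m : ℕ} {y : Fin m → L}

/-- In a subalgebra of a field, the inverse (in the field) of a unit is the inverse unit. [folklore] -/
theorem coe_units_inv_subalgebra {S : Subalgebra F L} (w : Sˣ) :
    ((↑w⁻¹ : S) : L) = ((w : S) : L)⁻¹ := by
  have h : ((w : S) : L) * ((↑w⁻¹ : S) : L) = 1 := by
    rw [← Subalgebra.coe_mul, Units.mul_inv, Subalgebra.coe_one]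
  exact (inv_eq_of_mul_eq_one_right h).symm

/-- **Inclusion criterion**: if the coordinates `x i` lie in the maximal ideal of `F[y]_{(y)}`
then `F[x]_{(x)} ⊆ F[y]_{(y)}` (denominators `g(x)`, `g(0) ≠ 0`, are units of `F[y]_{(y)}`).
[folklore] -/
theorem originLocalRing_le_of_forall_mem_maximalIdeal (hx : AlgebraicIndependent F x)
    (hy : AlgebraicIndependent F y) (hxy : ∀ i, x i ∈ originLocalRing hy)
    (hmax : ∀ i, haveI := isLocalRing_originLocalRing hy;
      (⟨x i, hxy i⟩ : originLocalRing hy) ∈ maximalIdeal (originLocalRing hy)) :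
    originLocalRing hx ≤ originLocalRing hy := by
  haveI := isLocalRing_originLocalRing hy
  intro q hq
  obtain ⟨f, g, hg, rfl⟩ := (mem_originLocalRing_iff hx).mp hq
  set x' : Fin n → originLocalRing hy := fun i => ⟨x i, hxy i⟩
  have hcoe : ∀ h : MvPolynomial (Fin n) F, aeval x h = ((aeval x' h : originLocalRing hy) : L) :=
    fun h => (coe_aeval_subalgebra _ x' h).symm
  obtain ⟨w, hw⟩ := isUnit_aeval_of_constantCoeff_ne_zero x' hmax hg
  rw [div_eq_mul_inv, hcoe f, hcoe g, ← hw, ← coe_units_inv_subalgebra, ← Subalgebra.coe_mul]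
  exact Subtype.mem _

/-- **Domination**: under the same hypothesis `F[y]_{(y)}` dominates `F[x]_{(x)}` — an element of
`F[x]_{(x)}` invertible in `F[y]_{(y)}` is invertible in `F[x]_{(x)}` (a fraction `f(x)/g(x)` with
`f(0) = 0` lies in the maximal ideal of `F[y]_{(y)}`, one with `f(0) ≠ 0` is a unit of
`F[x]_{(x)}`). [folklore] -/
theorem inv_mem_originLocalRing_of_forall_mem_maximalIdeal (hx : AlgebraicIndependent F x)
    (hy : AlgebraicIndependent F y) (hxy : ∀ i, x i ∈ originLocalRing hy)
    (hmax : ∀ i, haveI := isLocalRing_originLocalRing hy;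
      (⟨x i, hxy i⟩ : originLocalRing hy) ∈ maximalIdeal (originLocalRing hy))
    {q : L} (hq : q ∈ originLocalRing hx) (hinv : q⁻¹ ∈ originLocalRing hy) :
    q⁻¹ ∈ originLocalRing hx := by
  haveI := isLocalRing_originLocalRing hy
  obtain ⟨f, g, hg, rfl⟩ := (mem_originLocalRing_iff hx).mp hq
  by_cases hf : constantCoeff f = 0
  · -- `q` lies in the maximal ideal of `F[y]_{(y)}`, so is not a unit there: `q = 0`
    by_cases hq0 : aeval x f / aeval x g = 0
    · rw [hq0, inv_zero]; exact Subalgebra.zero_mem _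
    exfalso
    set x' : Fin n → originLocalRing hy := fun i => ⟨x i, hxy i⟩
    have hcoe : ∀ h : MvPolynomial (Fin n) F, aeval x h = ((aeval x' h : originLocalRing hy) : L) :=
      fun h => (coe_aeval_subalgebra _ x' h).symm
    obtain ⟨w, hw⟩ := isUnit_aeval_of_constantCoeff_ne_zero x' hmax hg
    have hqmem : aeval x f / aeval x g ∈ originLocalRing hy :=
      originLocalRing_le_of_forall_mem_maximalIdeal hx hy hxy hmax hq
    have hq' : (⟨aeval x f / aeval x g, hqmem⟩ : originLocalRing hy) = aeval x' f * ↑w⁻¹ := by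
      apply Subtype.ext
      change aeval x f / aeval x g = ((aeval x' f * ↑w⁻¹ : originLocalRing hy) : L)
      rw [Subalgebra.coe_mul, coe_units_inv_subalgebra, hw, ← hcoe f, ← hcoe g, div_eq_mul_inv]
    have hmemmax : (⟨aeval x f / aeval x g, hqmem⟩ : originLocalRing hy) ∈
        maximalIdeal (originLocalRing hy) := by
      rw [hq']
      exact Ideal.mul_mem_right _ _ (aeval_mem_maximalIdeal_of_constantCoeff_eq_zero x' hmax hf)
    have hunit : IsUnit (⟨aeval x f / aeval x g, hqmem⟩ : originLocalRing hy) :=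
      ⟨⟨_, ⟨_, hinv⟩, Subtype.ext (mul_inv_cancel₀ hq0), Subtype.ext (inv_mul_cancel₀ hq0)⟩, rfl⟩
    exact (IsLocalRing.mem_maximalIdeal _ |>.mp hmemmax) hunit
  · rw [inv_div]
    exact (mem_originLocalRing_iff hx).mpr ⟨g, f, hf, rfl⟩

end Field

end Literature.AlgebraicGeometry.Resolution

end
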